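import Summits.ResolutionOfSingularities.ResolutionOfSingularities.Theorems.FrobeniusClosingPatchingRelPerfectMonomialRouteKStepImg
import Literature.AlgebraicGeometry.Resolution.BlowupsEquivariant
import HarnessLib

/-!
# Crux `PatchingRelPerfect` (stmt-ResolutionOfSingularities-16161), chain w52 — TargetsF3 (m)
# «M2-strong», COMBINATORIAL HALF, Route K step K15: (C2') at the next level — the torus scalings of the
# new charts come from LIFTED automorphisms

[OURS · L1 W5.2 · design memo v3 (`L/res-type-075/M2STRONG-COMBINATORIAL-HALF.md`); fact-free;
nothing here is a statement of the manuscript under review]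

A scaling `t'` of the `j`-chart of the blow-up is, after the substitution `x_i ↦ x_j x_i`, the scaling
`t` of the base chart with `t_i = t'_i t'_j` (`i ∈ S ∖ j`); the automorphism `g` of `Y` provided by
(C2') at the base level stabilises the centre (file K9 `comap_head_eq`), hence LIFTS to an automorphism
`g'` of `Bl_C Y` (tree `IsBlowup.liftAut`, Görtz–Wedhorn I, Prop. 13.91 (1)), along which the tail of the
functorial sequence is again its own pull-back (`isPullbackAlong_cons_cons` + uniqueness of morphisms
of blow-ups), which stabilises the new boundary (`comap_newD_lift`: pull-backs, colons and unions of
ideal sheaves commute with pull-back along an isomorphism over `g`), hence the new chart (IMG, file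
K14), and which acts on the sections of the new chart by `t'` (ring maps out of `ℚ[x]` agreeing on the
image of the substitution and cancelling `x_j`): **`Good.newCharts_sym`**.
-/

-- `Summit.<Summit>.<Sub>.Theorems` with `Sub = Summit` (single-conjunct summit, D-0017)
set_option linter.dupNamespace false

noncomputable section

open CategoryTheory AlgebraicGeometry TopologicalSpace MvPolynomial
open Literature.AlgebraicGeometry.Resolution

namespace Summit.ResolutionOfSingularities.ResolutionOfSingularities.Theorems

namespace PolyhedraGame

namespace RouteK

variable {L : Finset ℕ}

/-! ## Pull-back of ideal sheaves along an isomorphism -/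

section ComapIso

variable {X X' : Scheme.{0}} (g : X ≅ X)

/-- [OURS] Pulling back along `g.hom` and `g.inv` are inverse to each other. -/
theorem comap_hom_comap_inv (K : X.IdealSheafData) : (K.comap g.hom).comap g.inv = K := by
  rw [← Scheme.IdealSheafData.comap_comp, Iso.inv_hom_id, Scheme.IdealSheafData.comap_id]

/-- [OURS] Pulling back along `g.inv` and `g.hom` are inverse to each other. -/
theorem comap_inv_comap_hom (K : X.IdealSheafData) : (K.comap g.inv).comap g.hom = K := by
  rw [← Scheme.IdealSheafData.comap_comp, Iso.hom_inv_id, Scheme.IdealSheafData.comap_id]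

/-- [OURS] Pull-back of ideal sheaves is monotone (pointwise form of `comap_mono`). -/
theorem comap_le_comap {Y : Scheme.{0}} (f : X' ⟶ Y) {A B : Y.IdealSheafData} (h : A ≤ B) :
    A.comap f ≤ B.comap f :=
  Scheme.IdealSheafData.comap_mono f h

/-- [OURS] Pull-back along an automorphism, as an order isomorphism of ideal sheaves. -/
def comapOrderIso : X.IdealSheafData ≃o X.IdealSheafData where
  toFun K := K.comap g.hom
  invFun K := K.comap g.inv
  left_inv K := comap_hom_comap_inv g K
  right_inv K := comap_inv_comap_hom g K
  map_rel_iff' := by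
    intro A B
    change A.comap g.hom ≤ B.comap g.hom ↔ A ≤ B
    constructor
    · intro h
      have := comap_le_comap g.inv h
      rwa [comap_hom_comap_inv, comap_hom_comap_inv] at this
    · exact fun h => comap_le_comap g.hom h

/-- [OURS] Pull-back along an automorphism commutes with unions. -/
theorem comap_iSup_iso {ι : Sort*} (K : ι → X.IdealSheafData) : (⨆ i, K i).comap g.hom = ⨆ i, (K i).comap g.hom :=
  (comapOrderIso g).map_iSup K

/-- [OURS] Pull-back along an automorphism commutes with intersections. -/
theorem comap_iInf_iso {ι : Sort*} (K : ι → X.IdealSheafData) : (⨅ i, K i).comap g.hom = ⨅ i, (K i).comap g.hom :=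
  (comapOrderIso g).map_iInf K

/-- [OURS] Pull-back along an automorphism commutes with colon ideal sheaves. -/
theorem comap_colon_iso (A B : X.IdealSheafData) : (colon A B).comap g.hom = colon (A.comap g.hom) (B.comap g.hom) := by
  apply le_antisymm
  · rw [le_colon_iff, ← comap_mul]
    exact comap_le_comap g.hom (mul_colon_le A B)
  · -- move to `g.inv`
    have h : (colon (A.comap g.hom) (B.comap g.hom)).comap g.inv ≤ colon A B := by
      rw [le_colon_iff]
      have := comap_le_comap g.inv (mul_colon_le (A.comap g.hom) (B.comap g.hom))
      rwa [comap_mul, comap_hom_comap_inv, comap_hom_comap_inv] at this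
    have := comap_le_comap g.hom h
    rwa [comap_inv_comap_hom] at this

end ComapIso

/-! ## The new boundary is stable under lifts -/

section Lift

variable {Y : Scheme.{0}} {C : Y.IdealSheafData} (g₀ : Y ≅ Y) (g' : blowup C ≅ blowup C)
  (hover : g'.hom ≫ blowup.π C = blowup.π C ≫ g₀.hom)
include hover

/-- [OURS] Pull-backs from the base are stable under a lift stabilising them below. -/
theorem comap_comap_lift (K : Y.IdealSheafData) (hK : K.comap g₀.hom = K) :
    (K.comap (blowup.π C)).comap g'.hom = K.comap (blowup.π C) := by
  rw [← Scheme.IdealSheafData.comap_comp, hover, Scheme.IdealSheafData.comap_comp, hK]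

variable (s : State) (D : ℕ → Y.IdealSheafData) (mv : List (Finset ℕ × ℕ))
  (hC : C.comap g₀.hom = C) (hD : ∀ l, (D l).comap g₀.hom = D l)
include hC hD

/-- [OURS · Route K] **The new boundary is stable under a lifted automorphism.** -/
theorem comap_newD_lift (l : ℕ) : (newD s D C mv l).comap g'.hom = newD s D C mv l := by
  unfold newD
  split_ifs with hl
  · rw [strictTransformIdeal, comap_iSup_iso]
    refine iSup_congr fun n => ?_
    rw [comap_colon_iso, comap_pow, comap_comap_lift g₀ g' hover (D l) (hD l),
      comap_comap_lift g₀ g' hover C hC]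
  · rw [comap_iInf_iso]
    refine iInf_congr fun p => ?_
    refine comap_comap_lift g₀ g' hover _ ?_
    rw [stratumIdeal, comap_iSup_iso]
    exact iSup_congr fun l => hD l

end Lift

/-! ## The sections of the new chart under the lift -/

section Sections

variable {Y Y' : Scheme.{0}} {π : Y' ⟶ Y} (c : Chart L Y) (lab : ℕ → ℕ) (g : Spec (Rc L) ⟶ Y')
  [IsOpenImmersion g] (ρ : MvPolynomial L ℚ →+* MvPolynomial L ℚ)
  (hg : g ≫ π = Spec.map (CommRingCat.ofHom (ρ.comp (c.e : Γ(Y, c.U) →+* MvPolynomial L ℚ))) ≫ c.U.2.fromSpec)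
include hg

/-- [OURS] The new chart lies over the old one. -/
theorem Chart.ofMap_U_le_preimage : ((Chart.ofMap lab g).U : Y'.Opens) ≤ π ⁻¹ᵁ (c.U : Y.Opens) :=
  image_top_le_preimage_of_comp_eq π g c.U _ hg

/-- [OURS] **The structure map of the new chart on sections is `ρ`**: `e' (π^* f) = ρ (e f)`. -/
theorem Chart.ofMap_e_appLE (f : Γ(Y, c.U)) :
    (Chart.ofMap lab g).e ((π.appLE c.U (Chart.ofMap lab g).U (Chart.ofMap_U_le_preimage c lab g ρ hg)).hom f) =
      ρ (c.e f) :=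
  congrArg (fun φ : Γ(Y, c.U) ⟶ Rc L => φ.hom f)
    (appLE_appIso_ΓSpecIso_of_comp_eq π g c.U _ hg (Chart.ofMap_U_le_preimage c lab g ρ hg))

end Sections

/-! ## The base scaling under a blow-up chart -/

section BaseScale

/-- [OURS] The base scaling inducing `t'` on the `j`-th chart of the blow-up along `V(x_S)`:
`t_b = t'_b t'_j` for `b ∈ S ∖ j` and `t_b = t'_b` otherwise. -/
def baseScale (S : Finset L) (j : L) (t' : L → ℚ) : L → ℚ := fun b =>
  if b ∈ S ∧ b ≠ j then t' b * t' j else t' b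

/-- [OURS] The base scaling has non-zero entries. -/
theorem baseScale_ne_zero (S : Finset L) (j : L) {t' : L → ℚ} (ht' : ∀ b, t' b ≠ 0) (b : L) :
    baseScale S j t' b ≠ 0 := by
  unfold baseScale
  split_ifs
  · exact mul_ne_zero (ht' b) (ht' j)
  · exact ht' b

/-- [OURS] **Hu's substitution intertwines the base scaling `t` with `t'`**: `ρ ∘ t = t' ∘ ρ`. -/
theorem coordBlowupSubst_comp_scaleHom (S : Finset L) (j : L) (t' : L → ℚ) :
    (coordBlowupSubst ℚ (S : Set L) j).comp (scaleHom (baseScale S j t')) =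
      (scaleHom t').comp (coordBlowupSubst ℚ (S : Set L) j) := by
  apply MvPolynomial.algHom_ext
  intro b
  rw [AlgHom.comp_apply, AlgHom.comp_apply, scaleHom_X, map_mul, coordBlowupSubst_C]
  by_cases hb : b ∈ S ∧ b ≠ j
  · rw [coordBlowupSubst_X_of_mem_of_ne ℚ (S : Set L) j (Finset.mem_coe.mpr hb.1) hb.2, map_mul, scaleHom_X,
      scaleHom_X]
    simp only [baseScale, if_pos hb, map_mul]
    ring
  · have hsub : coordBlowupSubst ℚ (S : Set L) j (MvPolynomial.X b) = MvPolynomial.X b := by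
      rw [not_and_or, not_not] at hb
      rcases hb with hb | rfl
      · exact coordBlowupSubst_X_of_not_mem ℚ (S : Set L) _ (fun h => hb (Finset.mem_coe.mp h))
      · exact coordBlowupSubst_X_self ℚ (S : Set L) _
    rw [hsub, scaleHom_X]
    simp only [baseScale, if_neg hb]

/-- [OURS] Pointwise form, with the substitution as a ring map. -/
theorem coordBlowupSubst_scaleHom (S : Finset L) (j : L) (t' : L → ℚ) (p : MvPolynomial L ℚ) :
    (coordBlowupSubst ℚ (S : Set L) j).toRingHom (scaleHom (baseScale S j t') p) =
      scaleHom t' ((coordBlowupSubst ℚ (S : Set L) j).toRingHom p) := by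
  have := AlgHom.congr_fun (coordBlowupSubst_comp_scaleHom S j t') p
  rw [AlgHom.comp_apply, AlgHom.comp_apply] at this
  exact this

/-- [OURS] Ring maps out of `ℚ[x]` that agree on the image of Hu's substitution, the first of which
scales `x_j` by a non-zero constant, agree (cancel `x_j` in the images of `x_j x_i`, `i ∈ S ∖ j`). -/
theorem ringHom_ext_of_subst (S : Finset L) {j : L} (hj : j ∈ S) {ψ₁ ψ₂ : MvPolynomial L ℚ →+* MvPolynomial L ℚ}
    (hagree : ∀ p, ψ₁ (coordBlowupSubst ℚ (S : Set L) j p) = ψ₂ (coordBlowupSubst ℚ (S : Set L) j p))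
    {q : ℚ} (hq : q ≠ 0) (hj₁ : ψ₁ (MvPolynomial.X j) = MvPolynomial.C q * MvPolynomial.X j) : ψ₁ = ψ₂ := by
  have hX : ∀ b : L, b ∉ S ∨ b = j → ψ₁ (MvPolynomial.X b) = ψ₂ (MvPolynomial.X b) := by
    intro b hb
    have := hagree (MvPolynomial.X b)
    rcases hb with hb | rfl
    · rwa [coordBlowupSubst_X_of_not_mem ℚ (S : Set L) j (fun h => hb (Finset.mem_coe.mp h))] at this
    · rwa [coordBlowupSubst_X_self] at this
  apply MvPolynomial.ringHom_ext
  · intro a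
    have := hagree (MvPolynomial.C a)
    rwa [coordBlowupSubst_C] at this
  · intro b
    by_cases hb : b ∈ S ∧ b ≠ j
    · -- cancel `x_j`
      have h1 := hagree (MvPolynomial.X b)
      rw [coordBlowupSubst_X_of_mem_of_ne ℚ (S : Set L) j (Finset.mem_coe.mpr hb.1) hb.2, map_mul, map_mul,
        ← hX j (Or.inr rfl), hj₁] at h1
      have hne : (MvPolynomial.C q * MvPolynomial.X j : MvPolynomial L ℚ) ≠ 0 :=
        mul_ne_zero (by rwa [Ne, MvPolynomial.C_eq_zero]) (MvPolynomial.X_ne_zero j)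
      exact mul_left_cancel₀ hne h1
    · rw [not_and_or, not_not] at hb
      exact hX b hb

end BaseScale

/-! ## (C2') at the next level -/

section Sym

variable {m : ℕ} {s : State} {Y : Scheme.{0}} {D : ℕ → Y.IdealSheafData} {M : MarkedIdeal Y}
  {C : Y.IdealSheafData} {rest : CentreSeq (blowup C)} {𝒞 : Set (Chart L Y)}
  (G : Good L m s Y D M (CentreSeq.cons C rest) 𝒞) (hm : 1 ≤ m) (hs : s.WF)
  {mv : List (Finset ℕ × ℕ)} (hmv : BlockPlay m s G.components mv)
include G hm hs hmv

/-- [OURS] **Core of (C2') at the next level** for a new chart `ofMap lab g` over `c` with structure map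
`ρ`: a base scaling `t` intertwined with `t'` by `ρ`, and a uniqueness principle for ring maps agreeing on
the image of `ρ`, give the symmetry `t'` of the new chart. -/
theorem Good.sym_ofMap {c : Chart L Y} (hc : c ∈ 𝒞) (lab : ℕ → ℕ) (g : Spec (Rc L) ⟶ blowup C)
    [IsOpenImmersion g] (ρ : MvPolynomial L ℚ →+* MvPolynomial L ℚ)
    (hg : g ≫ blowup.π C = Spec.map (CommRingCat.ofHom (ρ.comp (c.e : Γ(Y, c.U) →+* MvPolynomial L ℚ))) ≫
      c.U.2.fromSpec)
    (hc' : Chart.ofMap lab g ∈ newCharts 𝒞 C mv) (t t' : L → ℚ) (ht : ∀ b, t b ≠ 0)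
    (hρt : ∀ p, ρ (scaleHom t p) = scaleHom t' (ρ p))
    (hext : ∀ ψ₁ ψ₂ : MvPolynomial L ℚ →+* MvPolynomial L ℚ, (∀ p, ψ₁ (ρ p) = ψ₂ (ρ p)) →
      ψ₂ = (scaleHom t' : MvPolynomial L ℚ →+* MvPolynomial L ℚ) → ψ₁ = ψ₂) :
    ∃ (g' : blowup C ≅ blowup C) (h : ((Chart.ofMap lab g).U : (blowup C).Opens) ≤ g'.hom ⁻¹ᵁ (Chart.ofMap lab g).U),
      (∀ f, (Chart.ofMap lab g).e ((g'.hom.appLE (Chart.ofMap lab g).U (Chart.ofMap lab g).U h).hom f) =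
        scaleHom t' ((Chart.ofMap lab g).e f)) ∧
      CentreSeq.IsPullbackAlong g'.hom rest rest ∧ ∀ l, (newD s D C mv l).comap g'.hom = newD s D C mv l := by
  obtain ⟨g₀, h₀, happ₀, hpb₀, hD₀⟩ := G.sym c hc t ht
  obtain ⟨hC', g₁, hg₁, hpb₁⟩ := (CentreSeq.isPullbackAlong_cons_cons _ _ _ _ _).mp hpb₀
  have hC : C.comap g₀.hom = C := hC'.symm
  let g' : blowup C ≅ blowup C := (blowup.isBlowup C).liftAut g₀ hC
  have hover : g'.hom ≫ blowup.π C = blowup.π C ≫ g₀.hom := (blowup.isBlowup C).liftAut_hom_comp g₀ hC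
  have hg₁' : g₁ = g'.hom := blowup.hom_ext_over hC' hg₁ hover
  have hD' : ∀ l, (newD s D C mv l).comap g'.hom = newD s D C mv l :=
    comap_newD_lift g₀ g' hover s D mv hC hD₀
  -- the chart is stable
  have h' : ((Chart.ofMap lab g).U : (blowup C).Opens) ≤ g'.hom ⁻¹ᵁ (Chart.ofMap lab g).U := by
    intro y' hy'
    change g'.hom y' ∈ ((Chart.ofMap lab g).U : (blowup C).Opens)
    rw [G.newCharts_mem_U_iff hm hs hmv hc']
    intro l hl
    have : y' ∈ ((newD s D C mv l).comap g'.hom).support := by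
      rw [Scheme.IdealSheafData.support_comap]; exact hl
    rw [hD'] at this
    exact (G.newCharts_mem_U_iff hm hs hmv hc' y').mp hy' l this
  refine ⟨g', h', ?_, hg₁' ▸ hpb₁, hD'⟩
  -- the action on sections
  have hVU := Chart.ofMap_U_le_preimage c lab g ρ hg
  have h₂ : ((Chart.ofMap lab g).U : (blowup C).Opens) ≤ (blowup.π C ≫ g₀.hom) ⁻¹ᵁ (c.U : Y.Opens) :=
    fun x hx => h₀ (hVU hx)
  have key : ∀ (f₁ f₂ : blowup C ⟶ Y) (_ : f₁ = f₂) h₁ h₂ (x : Γ(Y, c.U)),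
      (f₁.appLE (c.U : Y.Opens) (Chart.ofMap lab g).U h₁).hom x =
        (f₂.appLE (c.U : Y.Opens) (Chart.ofMap lab g).U h₂).hom x := by
    intro f₁ f₂ e h₁ h₂ x; subst e; rfl
  -- `g'^*` and `g₀^*` are intertwined by `π^*`
  have hcomp : ∀ f : Γ(Y, c.U),
      (g'.hom.appLE (Chart.ofMap lab g).U (Chart.ofMap lab g).U h').hom
          (((blowup.π C).appLE c.U (Chart.ofMap lab g).U hVU).hom f) =
        ((blowup.π C).appLE c.U (Chart.ofMap lab g).U hVU).hom ((g₀.hom.appLE c.U c.U h₀).hom f) := by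
    intro f
    have e₁ := congrArg (fun φ => φ.hom f) (Scheme.Hom.appLE_comp_appLE g'.hom (blowup.π C) (c.U : Y.Opens)
      (Chart.ofMap lab g).U (Chart.ofMap lab g).U hVU h')
    have e₂ := congrArg (fun φ => φ.hom f) (Scheme.Hom.appLE_comp_appLE (blowup.π C) g₀.hom (c.U : Y.Opens)
      (c.U : Y.Opens) (Chart.ofMap lab g).U h₀ hVU)
    exact e₁.trans ((key _ _ hover _ h₂ f).trans e₂.symm)
  -- `e' ∘ g'^* ∘ e'⁻¹` agrees with the scaling `t'` on the image of `ρ`, hence everywhere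
  let ψ₁ : MvPolynomial L ℚ →+* MvPolynomial L ℚ :=
    ((Chart.ofMap lab g).e : Γ(blowup C, (Chart.ofMap lab g).U) →+* MvPolynomial L ℚ).comp
      ((g'.hom.appLE (Chart.ofMap lab g).U (Chart.ofMap lab g).U h').hom.comp
        ((Chart.ofMap lab g).e.symm : MvPolynomial L ℚ →+* Γ(blowup C, (Chart.ofMap lab g).U)))
  have hψ₁ : ∀ f, ψ₁ ((Chart.ofMap lab g).e f) =
      (Chart.ofMap lab g).e ((g'.hom.appLE (Chart.ofMap lab g).U (Chart.ofMap lab g).U h').hom f) := by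
    intro f
    simp only [ψ₁, RingHom.comp_apply, RingEquiv.coe_toRingHom, RingEquiv.symm_apply_apply]
  have hψ : ψ₁ = (scaleHom t' : MvPolynomial L ℚ →+* MvPolynomial L ℚ) := by
    refine hext ψ₁ _ (fun p => ?_) rfl
    have hp : ρ p = (Chart.ofMap lab g).e (((blowup.π C).appLE c.U (Chart.ofMap lab g).U hVU).hom (c.e.symm p)) := by
      rw [Chart.ofMap_e_appLE c lab g ρ hg, RingEquiv.apply_symm_apply]
    calc ψ₁ (ρ p)
        = (Chart.ofMap lab g).e ((g'.hom.appLE (Chart.ofMap lab g).U (Chart.ofMap lab g).U h').hom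
            (((blowup.π C).appLE c.U (Chart.ofMap lab g).U hVU).hom (c.e.symm p))) := by rw [hp, hψ₁]
      _ = (Chart.ofMap lab g).e (((blowup.π C).appLE c.U (Chart.ofMap lab g).U hVU).hom
            ((g₀.hom.appLE c.U c.U h₀).hom (c.e.symm p))) := by rw [hcomp]
      _ = ρ (c.e ((g₀.hom.appLE c.U c.U h₀).hom (c.e.symm p))) := Chart.ofMap_e_appLE c lab g ρ hg _
      _ = scaleHom t' (ρ p) := by rw [happ₀, hρt, RingEquiv.apply_symm_apply]
  intro f
  have := congrArg (fun ψ : MvPolynomial L ℚ →+* MvPolynomial L ℚ => ψ ((Chart.ofMap lab g).e f)) hψ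
  simpa only [hψ₁, RingHom.coe_coe] using this

/-- [OURS · Route K] **(C2') at the next level**: every torus scaling of a new chart is induced by an
automorphism of `Bl_C Y` along which the tail of the functorial sequence is its own pull-back and which
stabilises the new boundary. -/
theorem Good.newCharts_sym {c' : Chart L (blowup C)} (hc' : c' ∈ newCharts 𝒞 C mv)
    (t' : L → ℚ) (ht' : ∀ b, t' b ≠ 0) :
    ∃ (g' : blowup C ≅ blowup C) (h : (c'.U : (blowup C).Opens) ≤ g'.hom ⁻¹ᵁ (c'.U : (blowup C).Opens)),
      (∀ f, c'.e ((g'.hom.appLE c'.U c'.U h).hom f) = scaleHom t' (c'.e f)) ∧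
      CentreSeq.IsPullbackAlong g'.hom rest rest ∧ ∀ l, (newD s D C mv l).comap g'.hom = newD s D C mv l := by
  rcases hc' with ⟨c, hc, S, hS, j, e, hJe, rfl⟩ | ⟨c, hc, htop, rfl⟩
  · haveI := (famMap_spec c S hS).1 j
    have hg := (famMap_spec c S hS).2.1 j
    refine G.sym_ofMap hm hs hmv hc _ (famMap c S hS j) _ hg (Or.inl ⟨c, hc, S, hS, j, e, hJe, rfl⟩)
      (baseScale S (j : L) t') t' (baseScale_ne_zero S (j : L) ht') (coordBlowupSubst_scaleHom S (j : L) t') ?_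
    intro ψ₁ ψ₂ hagree hψ₂
    refine ringHom_ext_of_subst S j.2 hagree (ht' j) ?_
    have := hagree (MvPolynomial.X (j : L))
    rw [AlgHom.toRingHom_eq_coe, AlgHom.coe_toRingHom, coordBlowupSubst_X_self, hψ₂] at this
    rw [this]
    exact scaleHom_X t' (j : L)
  · haveI := (liftMap_spec c htop).1
    have hg := (liftMap_spec c htop).2.1
    refine G.sym_ofMap hm hs hmv hc _ (liftMap c htop) _ hg (Or.inr ⟨c, hc, htop, rfl⟩) t' t' ht' (fun p => rfl) ?_
    intro ψ₁ ψ₂ hagree _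
    exact RingHom.ext fun p => hagree p

end Sym

end RouteK

end PolyhedraGame

end Summit.ResolutionOfSingularities.ResolutionOfSingularities.Theorems

end
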